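import Literature.IUT.HodgeArakelov.GaloisPairCyclotomesThetaSync
import Literature.IUT.HodgeArakelov.MonoThetaCor110FamilyOfBase
import Literature.IUT.HodgeArakelov.ModelMonoThetaBaseDatumLim
import HarnessLib

/-!
# Bridge B12, `Π`-side junction — `GalCorPiXInput` at a BASE-DATUM family reduces to ONE isomorphism at `Π₀`
# (proof-only; the exact typed residual of [IUTchII] Cor. 1.11 (b)'s `Π`-side at Cor. 1.10's GENUINE family)

Mochizuki, *Inter-universal Teichmüller theory II*, §1, Corollary 1.11 (b), kurims manuscript (Dec. 2020) p. 49
ll. 22–35: the `Aut(G)`-orbit of isomorphisms `μ_Ẑ(G) ⥲ (l·Δ_Θ)(Π)` obtained from `α : Π/Δ ⥲ G` and "the natural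
isomorphism `μ_Ẑ(G_k) ⥲ μ_Ẑ(Π_X)` of [AbsTopIII], Corollary 1.10, (c)"; Corollary 1.10, p. 47 ll. 14–27 (the functor
`ℛ → ℱ` "which arises from a functorial algorithm in the topological group `Π`") [claim: Mochizuki2012, status:
disputed] (IUTchII §1 Cor 1.11, kurims p.49); [EtTh] Cor. 2.19 (i) p. 64 (cyclotomic rigidity: compatibility of the
rigidity isomorphism with all isomorphisms of mono-theta environments) [cite: MochizukiEtTh2009, Cor 2.19(i) p.64].
Record-only typing under the claim key `Mochizuki2012` (D-0012, disputed); abc-iut cell, layer L6, node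
`IUTchII:Cor1.11` (B12 lineage abc-iut-w4-d024) over node `IUTchII:Cor1.10` (abc-iut-w5-d145 / abc-iut-w4-d038).

Cor. 1.10's family in the tree is a BASE-DATUM family `X.family` (`MonoThetaCor110FamilyOfBase.lean`: constant
modules `X.A = (l·Δ_Θ)(Π₀)`, actions pulled back along the chosen comparisons `e_Π : Π ⥲ Π₀`, transport
`ρ_A(e_Π⁻¹ ≫ f ≫ e_{Π*})`); the GENUINE instance is abc-iut-w4-d038's `EtaleLevels.familyLim = (baseDatumLim …).family`.
This PROOF-ONLY file reduces the residual `Π`-side input `GalCorPiXInput A X.family` of Cor. 1.11 (the Cor. 1.10 (c)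
isomorphism at every `Π`, natural, `Π`-equivariant — `GaloisPairCyclotomesThetaSync.lean`) to data AT THE SINGLE GROUP
`Π₀`, and proves the reduction is EXACT:

* `GalCorPiXInput.nonempty_family_of_base` — SUFFICIENCY: one isomorphism `c : μ_Ẑ(Π₀/Δ₀) ⥲ (l·Δ_Θ)(Π₀)` that is
  (E) `Π₀`-EQUIVARIANT (`Π₀` acting on `μ_Ẑ(Π₀/Δ₀)` through `Π₀ ↠ Π₀/Δ₀` by the cyclotomic character, on `(l·Δ_Θ)(Π₀)`
  by `X.actA`) and (C) COMPATIBLE WITH `Aut(Π₀)` (`c ∘ μ_Ẑ(quotMap γ) = ρ_A(γ) ∘ c` for every topological automorphism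
  `γ` of `Π₀` — [AbsTopIII] Cor. 1.10 (c) "natural" + [EtTh] Cor. 2.19 (i)) yields `GalCorPiXInput A X.family`
  (`corPiX_Π := c ∘ μ_Ẑ(quotMap e_Π)`; naturality from (C) at the loop `e_Π⁻¹ ≫ h ≫ e_{Π*}` and the functor laws of
  `μ_Ẑ ∘ quotMap`; equivariance from (E) and `galCyclotomeMap_smul`);
* `GalCorPiXInput.exists_base_of_family` — NECESSITY: conversely any `GalCorPiXInput A X.family` gives such a `c`
  (its `corPiX` at `Π₀`, corrected by `ρ_A(e_{Π₀})⁻¹` — the family compares `Π₀` with itself along the CHOSEN `e_{Π₀}`,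
  which need not be the identity);
* `GalCorPiXInput.nonempty_family_iff` — the EXACT residual: `GalCorPiXInput A X.family` is inhabited iff (E)+(C) data
  exist at `Π₀`;
* `EtaleLevels.nonempty_galCorPiXInput_familyLim_iff` — the same sentence AT THE GENUINE NATURAL SYSTEM
  (`familyLim`, `baseDatumLim`: `(l·Δ_Θ)(𝕄_*)`, `ρ_A = rhoALim`), i.e. the typed statement of what the genuine
  `Π`-side of Cor. 1.11 still needs: ONE `Π^tp_{X̲̲}`-equivariant isomorphism `μ_Ẑ(Π^tp_{X̲̲}/Δ) ⥲ (l·Δ_Θ)(𝕄_*)`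
  compatible with the `Aut(Π^tp_{X̲̲})`-action `rhoALim` ([AbsTopIII] Cor. 1.10 (c) composed with the identification
  "`Δ_Θ ≅ Ẑ(1)`" AS GALOIS MODULES — the tree's `hZ` is the group-structure-only shadow — and [EtTh] Cor. 2.19 (i)).

HONEST FRAMING: bookkeeping over typed interfaces; no definition, no named `Prop` fact, nothing of another seat
edited or restated; the (E)+(C) datum is NOT constructed here (owner side: FACT-LIST F-0348 / [EtTh] §1–2); nothing
here bears on [IUTchIII] Cor. 3.12; typed ≠ discharged.
-/

namespace Literature.IUT.HodgeArakelov

open CategoryTheory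
open Literature.AnabelianGeometry.AbsoluteAnabelian

universe u

variable {S : ThetaSetting.{u}}

namespace GalCorPiXInput

variable [CompactSpace S.Gk] (A : AbsTopMonoids S) {P₀ : IsoClass S.PiX} (X : MonoThetaBaseDatum S P₀)

/-- **SUFFICIENCY — `GalCorPiXInput` at a base-datum family from ONE datum at `Π₀`** ([IUTchII] Cor. 1.11 (b) over
Cor. 1.10's family shape): an isomorphism `c : μ_Ẑ(Π₀/Δ₀) ⥲ (l·Δ_Θ)(Π₀)` which is (E) `Π₀`-equivariant and (C)
compatible with every topological automorphism `γ` of `Π₀` (`c ∘ μ_Ẑ(quotMap γ) = ρ_A(γ) ∘ c`) extends to the Cor. 1.10 (c)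
datum at EVERY `Π`, naturally and equivariantly: `corPiX_Π := c ∘ μ_Ẑ(quotMap e_Π)`.
[claim: Mochizuki2012, status: disputed] (IUTchII §1 Cor 1.11, kurims p.49) -/
theorem nonempty_family_of_base (c : ↥(A.quotObj P₀).galCyclotome ≃* X.A)
    (hE : ∀ (x : P₀.G) (ζ : (A.quotObj P₀).galCyclotome),
      c (haveI := (A.quotObj P₀).compactSpace_carrier; (QuotientGroup.mk x : P₀.G ⧸ A.Delta P₀) • ζ) = X.actA x (c ζ))
    (hC : ∀ (γ : P₀ ⟶ P₀) (ζ : (A.quotObj P₀).galCyclotome),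
      c (IsoClass.galCyclotomeMap (A.quotMap γ) ζ) = X.rhoA (IsoClass.homIso γ) (c ζ)) :
    Nonempty (GalCorPiXInput A X.family) := by
  -- the chosen comparisons `e_Π : Π ⟶ Π₀` of the family (`MonoThetaBaseDatum.cmp P₀ P`, as morphisms)
  let e : ∀ P : IsoClass S.PiX, P ⟶ P₀ := fun P => (IsoClass.nonempty_hom P P₀).some
  have he : ∀ P : IsoClass S.PiX, IsoClass.homIso (e P) = MonoThetaBaseDatum.cmp P₀ P := fun _ => rfl
  refine ⟨{ corPiX := fun P => (IsoClass.galCyclotomeMap (A.quotMap (e P))).trans c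
            corPiX_natural := ?_
            corPiX_equivariant := ?_ }⟩
  · intro P Q h x
    -- the loop `e_P⁻¹ ≫ h ≫ e_Q` at `Π₀`
    let γ : P₀ ⟶ P₀ := Groupoid.inv (e P) ≫ h ≫ e Q
    have hγ : e P ≫ γ = h ≫ e Q := by
      show e P ≫ (Groupoid.inv (e P) ≫ h ≫ e Q) = h ≫ e Q
      rw [← Category.assoc, Groupoid.comp_inv, Category.id_comp]
    have key : IsoClass.galCyclotomeMap (A.quotMap (e Q)) (IsoClass.galCyclotomeMap (A.quotMap h) x) =
        IsoClass.galCyclotomeMap (A.quotMap γ) (IsoClass.galCyclotomeMap (A.quotMap (e P)) x) := by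
      rw [← MulEquiv.trans_apply (IsoClass.galCyclotomeMap (A.quotMap h)), ← IsoClass.galCyclotomeMap_comp,
        ← A.quotMap_comp, ← MulEquiv.trans_apply (IsoClass.galCyclotomeMap (A.quotMap (e P))),
        ← IsoClass.galCyclotomeMap_comp, ← A.quotMap_comp, hγ]
    show c (IsoClass.galCyclotomeMap (A.quotMap (e Q)) (IsoClass.galCyclotomeMap (A.quotMap h) x)) =
      X.rhoA (MonoThetaBaseDatum.loopOf P₀ h) (c (IsoClass.galCyclotomeMap (A.quotMap (e P)) x))
    rw [key, hC]
    rfl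
  · intro P x ζ
    show c (IsoClass.galCyclotomeMap (A.quotMap (e P)) _) =
      X.actA (MonoThetaBaseDatum.cmp P₀ P x) (c (IsoClass.galCyclotomeMap (A.quotMap (e P)) ζ))
    rw [IsoClass.galCyclotomeMap_smul, ← he, A.quotMap_mk, hE]

/-- **NECESSITY**: a `GalCorPiXInput A X.family` yields the datum at `Π₀` — its `corPiX` at `Π₀` corrected by
`ρ_A(e_{Π₀})⁻¹` (the family compares `Π₀` with itself along the chosen `e_{Π₀}`, not along the identity).
[claim: Mochizuki2012, status: disputed] (IUTchII §1 Cor 1.11, kurims p.49) -/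
theorem exists_base_of_family (I : GalCorPiXInput A X.family) :
    ∃ c : ↥(A.quotObj P₀).galCyclotome ≃* X.A,
      (∀ (x : P₀.G) (ζ : (A.quotObj P₀).galCyclotome),
        c (haveI := (A.quotObj P₀).compactSpace_carrier; (QuotientGroup.mk x : P₀.G ⧸ A.Delta P₀) • ζ) =
          X.actA x (c ζ)) ∧
      ∀ (γ : P₀ ⟶ P₀) (ζ : (A.quotObj P₀).galCyclotome),
        c (IsoClass.galCyclotomeMap (A.quotMap γ) ζ) = X.rhoA (IsoClass.homIso γ) (c ζ) := by
  -- `e₀ := e_{Π₀}`, a topological automorphism of `Π₀`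
  let e₀ : P₀.G ≃ₜ* P₀.G := MonoThetaBaseDatum.cmp P₀ P₀
  refine ⟨(I.corPiX P₀).trans (X.rhoA e₀.symm), fun x ζ => ?_, fun γ ζ => ?_⟩
  · show X.rhoA e₀.symm (I.corPiX P₀ _) = X.actA x (X.rhoA e₀.symm (I.corPiX P₀ ζ))
    rw [I.corPiX_equivariant]
    show X.rhoA e₀.symm (X.actA (e₀ x) (I.corPiX P₀ ζ)) = _
    rw [X.rhoA_act, ContinuousMulEquiv.symm_apply_apply]
  · show X.rhoA e₀.symm (I.corPiX P₀ (IsoClass.galCyclotomeMap (A.quotMap γ) ζ)) =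
      X.rhoA (IsoClass.homIso γ) (X.rhoA e₀.symm (I.corPiX P₀ ζ))
    rw [I.corPiX_natural]
    show X.rhoA e₀.symm (X.rhoA (MonoThetaBaseDatum.loopOf P₀ γ) (I.corPiX P₀ ζ)) = _
    have hloop : MonoThetaBaseDatum.loopOf P₀ γ = (e₀.symm.trans (IsoClass.homIso γ)).trans e₀ := rfl
    rw [hloop, X.rhoA_trans, X.rhoA_trans, X.rhoA_symm, MulEquiv.trans_apply, MulEquiv.trans_apply,
      MulEquiv.symm_apply_apply]

/-- **The EXACT residual of the `Π`-side of [IUTchII] Cor. 1.11 (b) at a base-datum family**: `GalCorPiXInput A X.family`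
is inhabited iff there is ONE isomorphism `μ_Ẑ(Π₀/Δ₀) ⥲ (l·Δ_Θ)(Π₀)` which is `Π₀`-equivariant and compatible with the
`Aut(Π₀)`-action `ρ_A` ([AbsTopIII] Cor. 1.10 (c) naturality + [EtTh] Cor. 2.19 (i)).
[claim: Mochizuki2012, status: disputed] (IUTchII §1 Cor 1.11, kurims p.49) -/
theorem nonempty_family_iff :
    Nonempty (GalCorPiXInput A X.family) ↔
      ∃ c : ↥(A.quotObj P₀).galCyclotome ≃* X.A,
        (∀ (x : P₀.G) (ζ : (A.quotObj P₀).galCyclotome),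
          c (haveI := (A.quotObj P₀).compactSpace_carrier; (QuotientGroup.mk x : P₀.G ⧸ A.Delta P₀) • ζ) =
            X.actA x (c ζ)) ∧
        ∀ (γ : P₀ ⟶ P₀) (ζ : (A.quotObj P₀).galCyclotome),
          c (IsoClass.galCyclotomeMap (A.quotMap γ) ζ) = X.rhoA (IsoClass.homIso γ) (c ζ) :=
  ⟨fun ⟨I⟩ => exists_base_of_family A X I, fun ⟨c, hE, hC⟩ => nonempty_family_of_base A X c hE hC⟩

end GalCorPiXInput

/-! ## The same sentence at the GENUINE natural system (abc-iut-w4-d038's `familyLim` / `baseDatumLim`) -/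

namespace EtaleLevels

open Literature.AnabelianGeometry.EtaleTheta Literature.AnabelianGeometry.SemiGraphs
open scoped Literature.AnabelianGeometry.EtaleTheta

variable {p : ℕ} [Fact p.Prime] {D : Literature.AnabelianGeometry.EtaleTheta.ThetaSetting p}
  {E : D.EtaleThetaData} {l : ℕ} (C : E.DoubleUnderline l) (hC : D.Compat) (hS : D.Sec2Hyps)
  (hl : l.Prime) (hp2 : p ≠ 2) (hpl : p ≠ l) (hζ : ∃ ζ : D.K, IsPrimitiveRoot ζ (4 * l))
  (mods : ∀ M : ℕ+, D.CyclotomeMod l M)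
  (f : contCocycles D.toTheta D.DeltaTheta C.GtpYdduu) (hf : f ∈ C.rootCocycles hC)
  (hmods : ∀ (M M' : ℕ+) (h : (M : ℕ) ∣ (M' : ℕ)) (x : D.lDeltaTheta l),
    MuN.red p M M' h ((mods M').red x) = (mods M).red x)
  (h15 : Literature.AnabelianGeometry.EtaleTheta.ThetaSetting.Prop15iii E hC) (L : C.CuspLabels)
  (hZ : ∀ M : ℕ+, Nonempty (ModelCyclotomes.lDeltaQuot (C.rigidData (mods M) hC hS h15 L) ≃*
    Literature.IUT.HodgeTheaters.ZHat))
  (h218i₁ : (levelRigid C hC hS mods h15 L 1).Cor218_i)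

/-- **The `Π`-side residual of [IUTchII] Cor. 1.11 (b) AT THE GENUINE NATURAL SYSTEM, typed exactly**: for any Ex. 1.8
output `A` over the [EtTh]-model setting, the Cor. 1.10 (c) input `GalCorPiXInput A familyLim` over abc-iut-w4-d038's
genuine family is inhabited iff there is ONE isomorphism `μ_Ẑ(Π^tp_{X̲̲}/Δ) ⥲ (l·Δ_Θ)(𝕄_*)` (`baseDatumLim.A = intLim`)
that is `Π^tp_{X̲̲}`-equivariant (cyclotomic character vs `actIntLim`) and compatible with `rhoALim γ` for every topological
automorphism `γ` of `Π^tp_{X̲̲}` — i.e. [AbsTopIII] Cor. 1.10 (c) composed with "`Δ_Θ ≅ Ẑ(1)`" as `Π`-MODULES ([EtTh] §1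
p. 12; the binder `hZ` is its group-structure shadow) and [EtTh] Cor. 2.19 (i). Not constructed here.
[claim: Mochizuki2012, status: disputed] (IUTchII §1 Cor 1.11, kurims p.49) -/
theorem nonempty_galCorPiXInput_familyLim_iff [CompactSpace (setting C hC hS hl hp2 hpl hζ mods f hf).Gk]
    (A : AbsTopMonoids (setting C hC hS hl hp2 hpl hζ mods f hf)) :
    Nonempty (GalCorPiXInput A (familyLim C hC hS hl hp2 hpl hζ mods f hf hmods h15 L hZ h218i₁)) ↔
      ∃ c : ↥(A.quotObj (basePointLim C hC hS hl hp2 hpl hζ mods f hf hmods h15 L hZ)).galCyclotome ≃*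
          (baseDatumLim C hC hS hl hp2 hpl hζ mods f hf hmods h15 L hZ h218i₁).A,
        (∀ (x : (basePointLim C hC hS hl hp2 hpl hζ mods f hf hmods h15 L hZ).G)
            (ζ : (A.quotObj (basePointLim C hC hS hl hp2 hpl hζ mods f hf hmods h15 L hZ)).galCyclotome),
          c (haveI := (A.quotObj (basePointLim C hC hS hl hp2 hpl hζ mods f hf hmods h15 L hZ)).compactSpace_carrier;
              (QuotientGroup.mk x : _ ⧸ A.Delta _) • ζ) =
            (baseDatumLim C hC hS hl hp2 hpl hζ mods f hf hmods h15 L hZ h218i₁).actA x (c ζ)) ∧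
        ∀ (γ : basePointLim C hC hS hl hp2 hpl hζ mods f hf hmods h15 L hZ ⟶
              basePointLim C hC hS hl hp2 hpl hζ mods f hf hmods h15 L hZ)
            (ζ : (A.quotObj (basePointLim C hC hS hl hp2 hpl hζ mods f hf hmods h15 L hZ)).galCyclotome),
          c (IsoClass.galCyclotomeMap (A.quotMap γ) ζ) =
            (baseDatumLim C hC hS hl hp2 hpl hζ mods f hf hmods h15 L hZ h218i₁).rhoA (IsoClass.homIso γ) (c ζ) :=
  GalCorPiXInput.nonempty_family_iff A _

end EtaleLevels

end Literature.IUT.HodgeArakelov
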